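import Literature.IUT.HodgeTheaters.Cor53iiTelescopeKnit
import HarnessLib

/-!
# Layer-5 certificate v0.24 — BLOCK H over BUILT Literature modules only: [IUTchI] Cor 5.3 (ii) THREE-SLOT «bijective» at the
# genuine `ℱ`-kit of record (abc-iut-L5-lead gen 10 FINAL HANDOFF «V24 may add 'layer5_disch_cor53ii_v24_threeSlot' :=
# 'Cor53ii.threeSlot_bijective'», RULINGS #186 FLIP EDIT v2.15; CERT-L5 R73 holder abc-iut-L5-t16 gen 13; plan/L5/LAYER5-CERT-SPEC.md §7)

PROOF-ONLY (no `def`, no `instance`, no `axiom`, no `sorry`, no `notation`); NO `Conditional` import (architecture-neutral: serves a chained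
top `Layer5OfSV24` = `StatementOf v23 ∧ …` or any later flat top).  The one theorem is a landed Literature theorem VERBATIM (section
variables spelled in), proof BY NAME — one call:
* (C-53ii) `layer5_disch_cor53ii_v24_threeSlot` := abc-iut-w4-d109's `Cor53ii.threeSlot_bijective` (★ p541534) — at EVERY index of the
  genuine `ℱ`-kit of record «the natural map `Isom(¹𝔉, ²𝔉) → Isom(¹𝔇, ²𝔇)` is bijective», read index by index: (GOOD) the model case
  at the (S1) slot of record is bijective (★ p513350, FACT {F-1979 `Rmk253.TameGaloisCountable`, F-0004 `GeomAndArithSlim`} BY NAME);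
  (BAD) `Aut((Π ↷ 𝒪^▷_{K̄_v̲})) → {f ∈ Aut_top(Π) | f(Ker aug) = Ker aug}` bijective at the genuine `TM`-pair of `I.m2 x hx` (★ p540102,
  FACT ∅ · LAW ∅ — F-0174 / F-0409 PROVED rows BY NAME); (ARCH) the §0 binders inhabited and `Aut(ArchFSlot 𝔄 ℂ) → Aut(EA)` bijective
  (★ p499353, FACT ∅ · LAW ∅).  DISPLAYED binders exactly: the kit's {`D`, `CG`, `hS`, `M`, `hA`, `hI`, `B`, `ΛBad`, `I`} and the GOOD
  slot's two frozen FACTS {`hE2`, `h`}.  NOT claimed: anything about the INPUT category `(I.m1 x hx).Cv` (INPUT-SHAPE residual (r2) of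
  RULINGS #186); the Ker-compatibility target (r1) is displayed in the BAD conjunct itself.
CENSUS delta for §7 (the lead's booking): CONE +2 (Cor5.3(ii), Cor5.6(i) flipped by EDIT v2.15 OUTSIDE the chain; displayed here) · FACT +0
(F-1979 / F-0004 already counted at v0.21 (C-53ii)) · display +1.
S. Mochizuki, *Inter-universal Teichmüller theory I* [cite: Mochizuki2012] (D-0012 claim key; series status DISPUTED): Cor 5.3 (ii) p. 144;
Def 5.2 (iii)/(v)/(vi) pp. 134–136.  HONEST FRAMING: a CERT conjunct DISPLAYS its binders, it does not discharge them; the two FACTS are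
published theorems carried BY NAME as `Prop`s; nothing here asserts that abc is proved or refuted or takes a side on [IUTchIII] Cor. 3.12;
typed ≠ inhabited ≠ discharged; indexed ≠ endorsed.
-/

namespace Summit.ABC.IUTFork.Conditional

open CategoryTheory Opposite Literature.IUT.HodgeTheaters
open Literature.AnabelianGeometry.SemiGraphs Literature.AlgebraicGeometry.Frobenioids
open Literature.AnabelianGeometry.AbsoluteAnabelian Literature.NumberTheory.GaloisRepresentations
open scoped ValuativeRel

noncomputable section BlocksHV24

/-- **(C-53ii) [IUTchI] Cor 5.3 (ii) — THREE-SLOT «bijective» at the genuine `ℱ`-kit of record** (★ p541534 `Cor53ii.threeSlot_bijective`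
VERBATIM, the `AtTerm` binders {`D`, `CG`, `hS`, `M`, `hA`, `hI`, `B`, `ΛBad`, `I`} spelled in; FACT {F-1979 `hE2`, F-0004 `h`} of the GOOD
slot displayed): (GOOD) model case bijective at the (S1) slot of record · (BAD) `Aut(TM-pair) → Ker(aug)-compatible Aut_top(Π)` bijective ·
(ARCH) §0 binders inhabited and `Aut(ArchFSlot 𝔄 ℂ) → Aut(EA)` bijective.  LAW ∅.  NOT claimed: the INPUT category `(I.m1 x hx).Cv`.
[cite: Mochizuki2012, IUTchI Cor 5.3 (ii) p.144] [claim: Mochizuki2012, status: disputed] -/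
theorem layer5_disch_cor53ii_v24_threeSlot
    {F K Fbar : Type} [Field F] [NumberField F] [Field K] [NumberField K] [Algebra F K]
    [Field Fbar] [Algebra F Fbar] [Algebra K Fbar] {E : WeierstrassCurve F} [E.IsElliptic] {l : ℕ} {Pb : BadPlacePredicates K}
    (D : InitialThetaData F K Fbar E l Pb) (CG : D.geom.pe.CuspGalois) (hS : D.CuspClassesNormaliserStable) [Fact l.Prime]
    (M : D.TorsionMonodromy) (hA : D.geom.pe.ArrowCoveringClaims)
    (hI : ∀ k ∈ D.geom.pe.inertia D.geom.pe.ε1, M.tau (D.geom.embK k) = 0)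
    (B : ∀ v, v ∈ D.indexCopyBad → D.BadPairAt v) (ΛBad : ∀ v (h : v ∈ D.indexCopyBad), D.LocalArrowLaw CG hS (B v h).H)
    (I : D.MergeInputs B) (hE2 : Rmk253.TameGaloisCountable D.geom.extF)
    (h : Literature.AnabelianGeometry.AbsoluteAnabelian.FundamentalExtension.GeomAndArithSlim D.geom.extF) :
    (∀ (x : D.IndexCopy) (hx : x ∉ D.indexCopyArc) (hxb : x ∉ D.indexCopyBad) [Fact (D.primeAt x hx).Prime],
        letI := GaloisValDatum.normVal (D.KvAt x hx)
        Function.Bijective (fun α : SingleObj.star _ ≅ SingleObj.star _ =>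
          (show (D.baseKitThetaNFOfBadPairs CG hS M hA hI B ΛBad).model x ≅ (D.baseKitThetaNFOfBadPairs CG hS M hA hI B ΛBad).model x from
            (D.goodLiftToDAt CG hS M hA hI B ΛBad I x hx hxb).mapIso α))) ∧
    (∀ (x : D.IndexCopy) (hx : x ∈ D.indexCopyBad),
        haveI := D.fact_primeAt_prime x (D.not_mem_arc_of_mem_bad hx)
        haveI := GaloisValDatum.finiteDimensional_rescaledCompletion K (D.primeAt x (D.not_mem_arc_of_mem_bad hx))
          (D.specAt x (D.not_mem_arc_of_mem_bad hx)) (D.primeAt_mem x (D.not_mem_arc_of_mem_bad hx))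
        Function.Bijective (fun e : GaloisMonoidPair.Iso (I.m2 x hx).tmPair (I.m2 x hx).tmPair =>
          (⟨e.isoPi, Cor53ii.bad_isoPi_map_ker (I.m2 x hx) (I.m2 x hx) e⟩ :
            {f : ↥(B x hx).H ≃ₜ* ↥(B x hx).H // (I.m2 x hx).aug.ker.map f.toMulEquiv.toMonoidHom = (I.m2 x hx).aug.ker}))) ∧
    (∀ (x : D.IndexCopy) (_hx : x ∈ D.indexCopyArc) (𝔄 : AutHolFieldFunctor.{0}),
        (CatIsomorphism.HasUnder (ArchFSlot.toEA 𝔄 ℂ) (ArchFSlot.toEA 𝔄 ℂ) ∧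
          CatIsomorphism.UnderUnique (ArchFSlot.toEA 𝔄 ℂ) (ArchFSlot.toEA 𝔄 ℂ)) ∧
        ∀ (he : CatIsomorphism.HasUnder (ArchFSlot.toEA 𝔄 ℂ) (ArchFSlot.toEA 𝔄 ℂ))
          (hu : CatIsomorphism.UnderUnique (ArchFSlot.toEA 𝔄 ℂ) (ArchFSlot.toEA 𝔄 ℂ)),
          CatIsomorphism.DescendBijective (ArchFSlot.toEA 𝔄 ℂ) (ArchFSlot.toEA 𝔄 ℂ) he hu) :=
  Cor53ii.threeSlot_bijective D CG hS M hA hI B ΛBad I hE2 h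

end BlocksHV24

end Summit.ABC.IUTFork.Conditional

/-! ### Build-lane export guard (ops-buildfix bf1-g30, 2026-08-28; G11b-3 recipe v2 as in `GelbartRogawski1991/UnitaryDualPairSeesawCharacter`):
the theorems of this file carry very large dependent telescopes; at `.olean` export Lean 4.32's library-suggestion indexers fold over
every local theorem statement and do not finish within the build lane's one-hour clock (measured on a farm node: `lean -o` > 1 500 s, plain
elaboration ≈ 20 s). ONE file-final `local` `[implicit_reducible]` keeps them out of that premise index (inert for Meta and the kernel on
theorems; no definition is tagged; statements and proofs unchanged). -/
set_option allowUnsafeReducibility true in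
attribute [local implicit_reducible]
  _root_.Summit.ABC.IUTFork.Conditional.layer5_disch_cor53ii_v24_threeSlot
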